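import Summits.AtomisticToContinuum.HydrodynamicLimit.Theses.CollisionIsometryCLT
import Summits.AtomisticToContinuum.HydrodynamicLimit.Theses.StiffCollisionalRelaxation
import Summits.AtomisticToContinuum.HydrodynamicLimit.Theorems.CollisionIsometryCLTMacroClosureEngineDefs
import Summits.AtomisticToContinuum.HydrodynamicLimit.Theorems.CollisionIsometryCLTMacroClosureStubThermo
import Summits.AtomisticToContinuum.HydrodynamicLimit.Theorems.CollisionIsometryCLTMacroClosureStubInitialEntropy
import Summits.AtomisticToContinuum.HydrodynamicLimit.Theorems.CollisionIsometryCLTMacroClosureStubClausiusFor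
import Summits.AtomisticToContinuum.HydrodynamicLimit.Theorems.CollisionIsometryCLTMacroClosureEnginePointwise
import Summits.AtomisticToContinuum.HydrodynamicLimit.Theorems.CollisionIsometryCLTMacroClosureRuelleConvexity
import HarnessLib

/-!
# The UNIFORM DOCK of the crux `MacroClosure` (stmt-AtomisticToContinuum-14870): the strategist's split, landed

Support file (`--supports stmt-AtomisticToContinuum-14870`) of the line lead (continuation c2) landing the
crux-strategist's kernel-checked decomposition of `MacroClosure` on UNIFORM kinetic inputs (evidence `Split.lean`,
crux workfile `Cruxes/MacroClosure/Lines/uniform_dock.lean`, `STRATEGY-CENSUS.md`; a planner seat cannot write under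
`Theorems/`). Statements (defs, nothing asserted): `AprioriBoundsInBand` (byte-identical with
`StiffCollisionalRelaxation.AprioriBoundsInBand`, stmt-17749), `FastMomentRelaxationInBand` (stmt-14902 with `∃ η₁ > 0`
outermost), `MacroClosureInBand := CollisionalTransferLocality → AprioriBoundsInBand → FastMomentRelaxationInBand →
HydrodynamicLimit`. Pure-logic facts: the children imply the per-profile items of the route
(`aprioriBoundsPreShock_of_inBand`, `fmrPreShock_of_inBand`), child 2 is produced by the route's engine cruxes
(`fmrInBand_of_engine`) and by the sibling's hinge (`fmrInBand_of_stiff`), necessity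
(`macroClosureInBand_of_macroClosure`), the split glue (`MacroClosure_of_subs`), the re-keyed deciding shape
(`hydrodynamicLimit_of_inBand_route`), and THE DOCK WITHOUT stmt-3091: the landed pointwise engine fed with uniform
inputs gives the guarded conjunct (`hydrodynamicLimit_of_pointwise_inBand`), hence child 3 from the one-family block
MGF (`macroClosureInBand_of_blockMGF`). Why: since the Statement re-type (D-0032) the conjunct fixes `η₀` BEFORE the
profiles while the crux's hypotheses 14827/14902 fix `η₁` AFTER them; the uniform children make the landed engine dock
with `η₀ := min η₃ (min η₁ᴬ η₁ᶠ)/2`, the guard supplying the chamber, and remove `DiluteSelfConsistency` (3091,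
expected false) from the critical path.
-/

noncomputable section

open MeasureTheory Filter Set Topology InformationTheory
open scoped ENNReal ContDiff

namespace Summit.AtomisticToContinuum.HydrodynamicLimit.Theorems.MacroClosureLine.UniformDock

open Literature.MathematicalPhysics.KineticTheory Literature.Analysis.FluidPDE
open Literature.Analysis.FunctionSpaces
open Summit.AtomisticToContinuum.HydrodynamicLimit.Theses
open Summit.AtomisticToContinuum.HydrodynamicLimit.Theorems.MacroClosureLine
open Summit.AtomisticToContinuum.HydrodynamicLimit.Theorems.MacroClosureLine.Barycentric

/-! ## The three children (statements) -/

/-- CHILD 1 — **uniform pre-shock a-priori bounds** (byte-identical with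
`StiffCollisionalRelaxation.AprioriBoundsInBand`, stmt-AtomisticToContinuum-17749): the body of `AprioriBoundsPreShock`
(stmt-14827) with the dilute threshold `η₁` quantified BEFORE the profiles. -/
def AprioriBoundsInBand : Prop :=
  ∃ η₁ : ℝ, 0 < η₁ ∧ ∀ (a₀ θ₀ : (UnitAddTorus (Fin 3)) → ℝ) (u₀ : (UnitAddTorus (Fin 3)) → (EuclideanSpace ℝ (Fin 3))), Continuous a₀ → Continuous θ₀ → Continuous u₀ → (∀ x, 0 < a₀ x) → (∀ x, 0 < θ₀ x) → ∃ σ₀ : ℝ, 0 < σ₀ ∧ ∀ σ : ℝ, 0 < σ → σ < σ₀ → ∀ (T : ℝ) (ρ θ : ℝ → (UnitAddTorus (Fin 3)) → ℝ) (u : ℝ → (UnitAddTorus (Fin 3)) → (EuclideanSpace ℝ (Fin 3))), Literature.MathematicalPhysics.KineticTheory.IsHardSphereEulerSolution σ T ρ u θ → ∀ Φ : (N : ℕ) → Literature.Analysis.FluidPDE.HardSphereFlow (Literature.Analysis.FluidPDE.Torus.geometry (Fin 3)) (Literature.MathematicalPhysics.KineticTheory.hsDiameter σ N) (N + 1), Literature.MathematicalPhysics.KineticTheory.TendstoHydroFieldsAt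 (fun N => Literature.MathematicalPhysics.KineticTheory.localGibbsLaw σ a₀ u₀ θ₀ N (Φ N)) Φ ρ u θ 0 → ∀ t : ℝ, 0 < t → t < T → (∀ s ∈ Icc 0 t, ∀ x, 2 * ρ s x * σ ^ 3 < η₁) → (∃ lam Cexp : ℝ, 0 < lam ∧ Tendsto (fun N : ℕ => Literature.MathematicalPhysics.KineticTheory.localGibbsLaw σ a₀ u₀ θ₀ N (Φ N) {z | Cexp < ∫ s in Icc 0 t, ∫ y, Real.exp (lam * ‖y.2‖ ^ 2) ∂(Literature.Analysis.FluidPDE.empiricalMeasure ((Φ N).flow s z))}) atTop (𝓝 0)) ∧ (∀ (γ C : ℝ) (φ : ℕ → (UnitAddTorus (Fin 3)) → ℝ), 0 < γ → γ ≤ 1 / 15 → ((∀ N, Literature.Analysis.FunctionSpaces.Torus.IsSmooth (φ N)) ∧ (∀ N y, 0 ≤ φ N y) ∧ (∀ N, ∫ y, φ N y = 1) ∧ (∀ (N : ℕ) y, ((N : ℝ) + 1) ^ (-γ) ≤ Literature.Analysis.FluidPDE.Torus.euclidDist y 0 → φ N y = 0) ∧ (∀ (N : ℕ) y, φ N y ≤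 C * ((N : ℝ) + 1) ^ (3 * γ)) ∧ (∀ (N : ℕ) y, ‖Literature.Analysis.FunctionSpaces.Torus.gradient (φ N) y‖ ≤ C * ((N : ℝ) + 1) ^ (4 * γ))) → ∃ c₁ : ℝ, 0 < c₁ ∧ Tendsto (fun N : ℕ => Literature.MathematicalPhysics.KineticTheory.localGibbsLaw σ a₀ u₀ θ₀ N (Φ N) {z | ∃ s ∈ Icc 0 t, ∃ x : (UnitAddTorus (Fin 3)), Literature.MathematicalPhysics.KineticTheory.empiricalDensityField ((Φ N).flow s z) (fun y => φ N (y - x)) < c₁ ∨ 1 < Literature.MathematicalPhysics.KineticTheory.empiricalDensityField ((Φ N).flow s z) (fun y => φ N (y - x)) * σ ^ 3}) atTop (𝓝 0))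

/-- CHILD 2 — **uniform pre-shock kinetic hinge**: the body of `FastMomentRelaxationPreShock` (stmt-14902) with
`∃ η₁ > 0` moved OUTERMOST (before the profiles); produced in this route by
`DiffuseBackwardInfluence → AdaptedWeightCLT → AprioriBoundsInBand` (`fmrInBand_of_engine`). -/
def FastMomentRelaxationInBand : Prop :=
  ∃ η₁ : ℝ, 0 < η₁ ∧ ∀ (a₀ θ₀ : (UnitAddTorus (Fin 3)) → ℝ) (u₀ : (UnitAddTorus (Fin 3)) → (EuclideanSpace ℝ (Fin 3))), Continuous a₀ → Continuous θ₀ → Continuous u₀ → (∀ x, 0 < a₀ x) → (∀ x, 0 < θ₀ x) → ∃ σ₀ : ℝ, 0 < σ₀ ∧ ∀ σ : ℝ, 0 < σ → σ < σ₀ → ∀ (T : ℝ) (ρ θ : ℝ → (UnitAddTorus (Fin 3)) → ℝ) (u : ℝ → (UnitAddTorus (Fin 3)) → (EuclideanSpace ℝ (Fin 3))), Literature.MathematicalPhysics.KineticTheory.IsHardSphereEulerSolution σ T ρ u θ → ∀ Φ : (N : ℕ) → Literature.Analysis.FluidPDE.HardSphereFlow (Literature.Analysis.FluidPDE.Torus.geometry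 (Fin 3)) (Literature.MathematicalPhysics.KineticTheory.hsDiameter σ N) (N + 1), Literature.MathematicalPhysics.KineticTheory.TendstoHydroFieldsAt (fun N => Literature.MathematicalPhysics.KineticTheory.localGibbsLaw σ a₀ u₀ θ₀ N (Φ N)) Φ ρ u θ 0 → ∀ (γ C : ℝ) (φ : ℕ → (UnitAddTorus (Fin 3)) → ℝ), 0 < γ → γ ≤ 1 / 15 → ((∀ N, Literature.Analysis.FunctionSpaces.Torus.IsSmooth (φ N)) ∧ (∀ N y, 0 ≤ φ N y) ∧ (∀ N, ∫ y, φ N y = 1) ∧ (∀ (N : ℕ) y, ((N : ℝ) + 1) ^ (-γ) ≤ Literature.Analysis.FluidPDE.Torus.euclidDist y 0 → φ N y = 0) ∧ (∀ (N : ℕ) y, φ N y ≤ C * ((N : ℝ) + 1) ^ (3 * γ)) ∧ (∀ (N : ℕ) y, ‖Literature.Analysis.FunctionSpaces.Torus.gradient (φ N) y‖ ≤ C * ((N : ℝ) + 1) ^ (4 * γ))) → let ρb := fun (N : ℕ) (z : Literature.Analysis.FluidPDE.Config (N + 1) (Fin 3) (UnitAddTorus (Fin 3))) (x : (UnitAddTorus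 (Fin 3))) => Literature.MathematicalPhysics.KineticTheory.empiricalDensityField z (fun y => φ N (y - x)); let mb := fun (N : ℕ) (z : Literature.Analysis.FluidPDE.Config (N + 1) (Fin 3) (UnitAddTorus (Fin 3))) (x : (UnitAddTorus (Fin 3))) => Literature.MathematicalPhysics.KineticTheory.empiricalMomentumField z (fun y => φ N (y - x)); let ub := fun (N : ℕ) (z : Literature.Analysis.FluidPDE.Config (N + 1) (Fin 3) (UnitAddTorus (Fin 3))) (x : (UnitAddTorus (Fin 3))) => (ρb N z x)⁻¹ • mb N z x; let D := fun (N : ℕ) (z : Literature.Analysis.FluidPDE.Config (N + 1) (Fin 3) (UnitAddTorus (Fin 3))) (x : (UnitAddTorus (Fin 3))) (j k : Fin 3) => (∫ y, φ N (y.1 - x) * ((y.2 j - ub N z x j) * (y.2 k - ub N z x k)) ∂(Literature.Analysis.FluidPDE.empiricalMeasure z)) - (if j = k then (∑ l : Fin 3, ∫ y, φ N (y.1 - x) * (y.2 l - ub N z x l) ^ 2 ∂(Literature.Analysis.FluidPDE.empiricalMeasure z)) / 3 else 0); let q := fun (N : ℕ) (z : Literature.Analysis.FluidPDE.Config (N +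 1) (Fin 3) (UnitAddTorus (Fin 3))) (x : (UnitAddTorus (Fin 3))) => ∫ y, (φ N (y.1 - x) * ‖y.2 - ub N z x‖ ^ 2 / 2) • (y.2 - ub N z x) ∂(Literature.Analysis.FluidPDE.empiricalMeasure z); ∀ t : ℝ, 0 < t → t < T → (∀ s ∈ Icc 0 t, ∀ x, 2 * ρ s x * σ ^ 3 < η₁) → ∀ δ : ℝ, 0 < δ → Tendsto (fun N : ℕ => Literature.MathematicalPhysics.KineticTheory.localGibbsLaw σ a₀ u₀ θ₀ N (Φ N) {z | δ < ∫ s in Icc 0 t, ∫ x, ((∑ j, ∑ k, D N ((Φ N).flow s z) x j k ^ 2) + ‖q N ((Φ N).flow s z) x‖ ^ 2)}) atTop (𝓝 0)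

/-- CHILD 3 — **the macroscopic closure interface on uniform inputs**: collisional transfer locality, the UNIFORM
pre-shock a-priori bounds and the UNIFORM pre-shock hinge give the packing-guarded conjunct. -/
def MacroClosureInBand : Prop :=
  CollisionIsometryCLT.CollisionalTransferLocality → AprioriBoundsInBand → FastMomentRelaxationInBand → _root_.HydrodynamicLimit

/-! ## Position of the children among the typed items (pure logic) -/

/-- Child 1 IS the Stiff route's crux stmt-17749. -/
theorem aprioriBoundsInBand_iff_stiff :
    AprioriBoundsInBand ↔ StiffCollisionalRelaxation.AprioriBoundsInBand := Iff.rfl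

/-- Child 1 implies the per-profile a-priori crux of this route (stmt-14827): take the same `η₁` for every
profile. [folklore] -/
theorem aprioriBoundsPreShock_of_inBand (h : AprioriBoundsInBand) : CollisionIsometryCLT.AprioriBoundsPreShock := by
  obtain ⟨η₁, hη₁, H⟩ := h
  intro a₀ θ₀ u₀ ha hθ hu ha0 hθ0
  obtain ⟨σ₀, hσ₀, H'⟩ := H a₀ θ₀ u₀ ha hθ hu ha0 hθ0
  exact ⟨σ₀, hσ₀, η₁, hη₁, H'⟩

/-- Child 2 implies the per-profile pre-shock hinge of this route (stmt-14902, the route's target). [folklore] -/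
theorem fmrPreShock_of_inBand (h : FastMomentRelaxationInBand) : CollisionIsometryCLT.FastMomentRelaxationPreShock := by
  obtain ⟨η₁, hη₁, H⟩ := h
  intro a₀ θ₀ u₀ ha hθ hu ha0 hθ0
  obtain ⟨σ₀, hσ₀, H'⟩ := H a₀ θ₀ u₀ ha hθ hu ha0 hθ0
  exact ⟨σ₀, hσ₀, η₁, hη₁, H'⟩

/-- The sibling's ∀-t hinge (stmt-9522) implies child 2 (`η₁ := 1`, Euler conditioning and proviso unused).
[folklore] -/
theorem fmrInBand_of_stiff (h : StiffCollisionalRelaxation.FastMomentRelaxation) : FastMomentRelaxationInBand := by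
  refine ⟨1, one_pos, ?_⟩
  intro a₀ θ₀ u₀ ha hθ hu ha0 hθ0
  obtain ⟨σ₀, hσ₀, H⟩ := h a₀ θ₀ u₀ ha hθ hu ha0 hθ0
  refine ⟨σ₀, hσ₀, ?_⟩
  intro σ hσ hσlt T ρ θ u _hsol Φ _hLLN γ C φ hγ hγ' hadm ρb mb ub D q t ht _htT _hdil δ hδ
  exact H σ hσ hσlt Φ γ C φ hγ hγ' hadm t ht δ hδ

/-- **Child 2 is produced by this route's engine cruxes** once the a-priori input is uniform: the inline kinetic
glue of `closes` (`KineticEngineGlue`, stmt-14871), re-run with `η₁` taken from `AprioriBoundsInBand` BEFORE the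
profiles. [folklore] -/
theorem fmrInBand_of_engine (hD : CollisionIsometryCLT.DiffuseBackwardInfluence) (hC : CollisionIsometryCLT.AdaptedWeightCLT) (h₃ : AprioriBoundsInBand) :
    FastMomentRelaxationInBand := by
  obtain ⟨η₁, hη₁, H3⟩ := h₃
  refine ⟨η₁, hη₁, ?_⟩
  intro a₀ θ₀ u₀ ha hθ hu hapos hθpos
  obtain ⟨σ₁, hσ₁, H1⟩ := hD a₀ θ₀ u₀ ha hθ hu hapos hθpos
  obtain ⟨σ₂, hσ₂, H2⟩ := hC a₀ θ₀ u₀ ha hθ hu hapos hθpos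
  obtain ⟨σ₃, hσ₃, H3'⟩ := H3 a₀ θ₀ u₀ ha hθ hu hapos hθpos
  refine ⟨min σ₁ (min σ₂ σ₃), lt_min hσ₁ (lt_min hσ₂ hσ₃), ?_⟩
  intro σ hσ hσlt T ρ θ u hsol Φ hLLN
  have h1 := H1 σ hσ (lt_of_lt_of_le hσlt (min_le_left _ _))
  have h2 := H2 σ hσ (lt_of_lt_of_le hσlt ((min_le_right _ _).trans (min_le_left _ _)))
  have h3 := H3' σ hσ (lt_of_lt_of_le hσlt ((min_le_right _ _).trans (min_le_right _ _))) T ρ θ u hsol Φ hLLN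
  intro γ C φ hγ hγ' hadm ρb mb ub D q t ht htT hdil δ hδ
  exact h2 Φ (h1 Φ) γ C φ hγ hγ' hadm t ht (h3 t ht htT hdil).1 δ hδ

/-- **Necessity**: the crux as typed implies child 3 (uniform hypotheses are stronger, so the uniform interface is
weaker). [folklore] -/
theorem macroClosureInBand_of_macroClosure (hM : CollisionIsometryCLT.MacroClosure) : MacroClosureInBand :=
  fun h₂ h₃ hF => hM h₂ (aprioriBoundsPreShock_of_inBand h₃) (fmrPreShock_of_inBand hF)

/-- The re-keyed deciding shape (for the tenure planner): the route's two engine cruxes, the UNIFORM a-priori crux,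
collisional transfer locality and child 3 decide the sub-problem. [folklore] -/
theorem hydrodynamicLimit_of_inBand_route (hD : CollisionIsometryCLT.DiffuseBackwardInfluence) (hC : CollisionIsometryCLT.AdaptedWeightCLT)
    (h₃ : AprioriBoundsInBand) (h₂ : CollisionIsometryCLT.CollisionalTransferLocality) (hM : MacroClosureInBand) :
    _root_.HydrodynamicLimit :=
  hM h₂ h₃ (fmrInBand_of_engine hD hC h₃)

/-! ## The dock: child 3 from the landed engine and ONE statics input (no `DiluteSelfConsistency`) -/

/-- **Uniform threshold bookkeeping**: the pointwise engine (landed `stub_engine_pointwise`), fed with the UNIFORM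
a-priori bounds, the UNIFORM hinge, collisional transfer locality and Clausius in mean for ONE admissible kernel
family, gives the packing-guarded conjunct with `η₀ := min η₃ (min η₁ᴬ η₁ᶠ) / 2` chosen before the profiles and
`σ₀ := min (1/2) (min σ_C (min σ_A (min σ_F σ_Cl)))` per profile — the guard of the conjunct supplies the chamber
and both dilute provisos. (Verbatim the lead's `engineLocal_of_pointwise`, with the two `obtain`s of the thresholds
moved before the profiles.) [folklore] -/
theorem hydrodynamicLimit_of_pointwise_inBand (η₃ : ℝ) (hη₃ : 0 < η₃) (hT : ThermoChamber η₃)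
    (hH : StiffCollisionalRelaxation.HsFreeEnergyConvex)
    (γ C : ℝ) (φ : ℕ → T3 → ℝ) (hγ : 0 < γ) (hγ' : γ ≤ 1 / 15) (hφ : AdmissibleKernel γ C φ)
    (hCl : ClausiusInMeanFor γ C φ)
    (hC : CollisionIsometryCLT.CollisionalTransferLocality) (hA : AprioriBoundsInBand) (hF : FastMomentRelaxationInBand) :
    _root_.HydrodynamicLimit := by
  obtain ⟨ηA, hηA, HA0⟩ := hA
  obtain ⟨ηF, hηF, HF0⟩ := hF
  refine ⟨min η₃ (min ηA ηF) / 2, by positivity, ?_⟩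
  intro a₀ θ₀ u₀ ha hθ hu ha0 hθ0
  obtain ⟨σC, hσC, HC⟩ := hC a₀ θ₀ u₀ ha hθ hu ha0 hθ0
  obtain ⟨σA, hσA, HA⟩ := HA0 a₀ θ₀ u₀ ha hθ hu ha0 hθ0
  obtain ⟨σF, hσF, HF⟩ := HF0 a₀ θ₀ u₀ ha hθ hu ha0 hθ0
  obtain ⟨σL, hσL, HL⟩ := hCl a₀ θ₀ u₀ ha hθ hu ha0 hθ0
  refine ⟨min (1 / 2) (min σC (min σA (min σF σL))),
    lt_min one_half_pos (lt_min hσC (lt_min hσA (lt_min hσF hσL))), ?_⟩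
  intro σ hσ hσlt T ρ θ u hsol hguard Φ h0 t ht
  have hσ2 : σ < 2⁻¹ := by
    have := lt_of_lt_of_le hσlt (min_le_left _ _); norm_num at this ⊢; linarith
  have hσC' : σ < σC := lt_of_lt_of_le hσlt ((min_le_right _ _).trans (min_le_left _ _))
  have hσA' : σ < σA :=
    lt_of_lt_of_le hσlt ((min_le_right _ _).trans ((min_le_right _ _).trans (min_le_left _ _)))
  have hσF' : σ < σF := lt_of_lt_of_le hσlt
    ((min_le_right _ _).trans ((min_le_right _ _).trans ((min_le_right _ _).trans (min_le_left _ _))))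
  have hσL' : σ < σL := lt_of_lt_of_le hσlt
    ((min_le_right _ _).trans ((min_le_right _ _).trans ((min_le_right _ _).trans (min_le_right _ _))))
  -- `t = 0` is the hypothesis itself
  rcases (eq_or_lt_of_le ht.1) with h | htpos
  · subst h; exact h0
  have htT : t < T := ht.2
  -- the chamber of `ThermoChamber η₃` and the two dilute provisos on `[0,t]`, all from the GUARD
  have hσ3 : 0 < σ ^ 3 := pow_pos hσ 3
  have hch : ∀ s ∈ Ico 0 T, ∀ x, ρ s x * σ ^ 3 < η₃ := fun s hs x =>
    (hguard s hs x).trans_le ((half_le_self (by positivity)).trans (min_le_left _ _))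
  have hprovA : ∀ s ∈ Icc 0 t, ∀ x, 2 * ρ s x * σ ^ 3 < ηA := by
    intro s hs x
    have h1 := hguard s ⟨hs.1, hs.2.trans_lt htT⟩ x
    have h2 : min η₃ (min ηA ηF) / 2 ≤ ηA / 2 := by
      gcongr; exact (min_le_right _ _).trans (min_le_left _ _)
    linarith
  have hprovF : ∀ s ∈ Icc 0 t, ∀ x, 2 * ρ s x * σ ^ 3 < ηF := by
    intro s hs x
    have h1 := hguard s ⟨hs.1, hs.2.trans_lt htT⟩ x
    have h2 : min η₃ (min ηA ηF) / 2 ≤ ηF / 2 := by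
      gcongr; exact (min_le_right _ _).trans (min_le_right _ _)
    linarith
  -- instantiate the three kinetic hypotheses
  have hA' := HA σ hσ hσA' T ρ θ u hsol Φ h0 t htpos htT hprovA
  have hF' := HF σ hσ hσF' T ρ θ u hsol Φ h0 γ C φ hγ hγ' hφ t htpos htT hprovF
  -- the tests `(lamM, lamE)` are smooth on `[0,t]`
  have hθinv : Torus.IsSmoothSpaceTimeOn (Ico 0 T) (fun s x => (θ s x)⁻¹) :=
    ContDiffOn.inv hsol.smooth_temperature fun p hp =>
      (hsol.temperature_pos p.1 (mem_prod.1 hp).1 (Torus.proj p.2)).ne'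
  have hlamM : Torus.IsSmoothSpaceTimeOn (Icc 0 t) (lamM θ u) :=
    (hθinv.smul hsol.smooth_velocity).mono (Icc_subset_Ico_right htT)
  have hlamE : Torus.IsSmoothSpaceTimeOn (Icc 0 t) (lamE θ) :=
    hθinv.neg.mono (Icc_subset_Ico_right htT)
  have hC' := HC σ hσ hσC' Φ γ C φ hγ hγ' hφ t htpos (lamM θ u) (lamE θ) hlamM hlamE
  have hCl' := HL σ hσ hσL' T ρ θ u hsol Φ h0 hγ hγ' hφ
  refine stub_engine_pointwise σ hσ hσ2 hH a₀ θ₀ u₀ ha hθ hu ha0 hθ0 T ρ θ u hsol η₃ hT hch Φ h0 γ C φ hγ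
    hγ' hφ t htpos htT hA'.1 (hA'.2 γ C φ hγ hγ' hφ) hF' hC' ?_
  intro c₁ hc₁ G hGm hGg hGb hGc
  exact hCl' c₁ t hc₁ htpos htT G hGm hGg hGb hGc

/-- **THE DOCK WITHOUT stmt-3091.** If ONE admissible kernel family carries the homogeneous sub-unit block MGF on the
band (`BlockMGFFor` — the lead's registered `stub_blockMGF`, the single open statics input of line
`IdeatorTwoGen1Sketch`), then child 3 holds: thermodynamics in the chamber (`stub_thermo`, landed), Ruelle convexity
(`stub_hsFreeEnergyConvex`, landed), the initial entropy value (`stub_initialEntropy`, landed) and Clausius in mean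
for that family (`stub_clausius_for`, landed) feed the landed pointwise engine, and the conjunct's guard supplies the
chamber. [folklore] -/
theorem macroClosureInBand_of_blockMGF
    (hB : ∃ (γ C : ℝ) (φ : ℕ → T3 → ℝ), 0 < γ ∧ γ ≤ 1 / 15 ∧ AdmissibleKernel γ C φ ∧ BlockMGFFor γ C φ) :
    MacroClosureInBand := by
  intro hC hA hF
  obtain ⟨η₃, hη₃, hT⟩ := stub_thermo
  obtain ⟨γ, C, φ, hγ, hγ', hφ, hM⟩ := hB
  have hCl : ClausiusInMeanFor γ C φ := stub_clausius_for stub_hsFreeEnergyConvex γ C φ hM stub_initialEntropy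
  exact hydrodynamicLimit_of_pointwise_inBand η₃ hη₃ hT stub_hsFreeEnergyConvex γ C φ hγ hγ' hφ hCl hC hA hF

/-- **Split glue**: the three children give the crux as typed (the per-profile hypotheses of the crux are discarded
in favour of the uniform children). [folklore] -/
theorem MacroClosure_of_subs : AprioriBoundsInBand → FastMomentRelaxationInBand → MacroClosureInBand → CollisionIsometryCLT.MacroClosure :=
  fun h₁ h₂ h₃ hC _ _ => h₃ hC h₁ h₂

/-- Corollary: the crux as typed from the one-family block MGF and the two uniform kinetic inputs. [folklore] -/
theorem macroClosure_of_blockMGF_of_inBand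
    (hB : ∃ (γ C : ℝ) (φ : ℕ → T3 → ℝ), 0 < γ ∧ γ ≤ 1 / 15 ∧ AdmissibleKernel γ C φ ∧ BlockMGFFor γ C φ)
    (h₁ : AprioriBoundsInBand) (h₂ : FastMomentRelaxationInBand) : CollisionIsometryCLT.MacroClosure :=
  MacroClosure_of_subs h₁ h₂ (macroClosureInBand_of_blockMGF hB)

end Summit.AtomisticToContinuum.HydrodynamicLimit.Theorems.MacroClosureLine.UniformDock

end
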